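import Summits.HubbardSuperconductivity.HubbardSuperconductivity.Theorems.SoloBlindSectorGibbsEntropy
import HarnessLib

/-!
# Thermal penalty transfer with an explicit (entropy) price

Solo programme `solo-HubbardSuperconductivity-blind`, structural Theorem 18, part (b) (abstract;
part (a) = `SoloBlindSectorGibbsEntropy`, Hubbard corollaries = `SoloBlindThermalPenaltyEntropy`).
`A`, `O` Hermitian leaving a subspace `K` invariant, `s > 0`, `β > 0`, `P_K` the orthogonal
projection, `⟨M⟩ = tr (P_K e^{-β(A+sO)} M) / tr (P_K e^{-β(A+sO)})` the canonical sector Gibbs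
average of the PENALISED Hamiltonian `A + sO`, `D = dim K`, `E₀(·) = minEnergyOn · K`.

* `groundState_re_rayleigh_ge_of_sectorGibbs_penalised` — if `re ⟨O⟩ ≥ a` then EVERY unit ground
  state `φ ∈ K` of `A` has `re ⟨φ, O φ⟩ ≥ a - log D / (β s)`:
  `E₀(A) Z + s tr(P e^{-βB} O) ≤ tr (P e^{-βB} B) ≤ (E₀(B) + log D/β) Z ≤ (E₀(A) + s⟨φ,Oφ⟩ + log D/β) Z`.
  Compare Theorem 17 (`SoloBlindPenaltyTransfer.hubbardSuperconductivity_of_eventually_penalised_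
  thermal`), which needed `β → ∞` at fixed volume at an uncontrolled (gap-dependent) rate: the rate
  is replaced by the explicit, gap-free entropy term `log D / (β s)`. No gap, no uniqueness.
* `re_sectorGibbs_penalised_ge_of_certificate` — converse direction: a zero-temperature
  certificate `a ≤ re⟨φ,Oφ⟩ + κ (re⟨φ,Aφ⟩ - E₀(A))` on the unit sphere of `K` (`κ ≥ 0`) and
  `0 ≤ O ≤ Bd` give `re ⟨O⟩ ≥ a - κ (s Bd + log D / β)` for all `s, β > 0`.

Elementary (two variational inequalities and the entropy price). [this work]
-/

noncomputable section

namespace Summit.HubbardSuperconductivity.HubbardSuperconductivity.Theorems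

open Matrix Filter Topology Literature.MathematicalPhysics.QuantumLattice
  Literature.MathematicalPhysics.QuantumLattice.EigenvalueContinuation
open scoped ComplexOrder

section Abstract

variable {n : Type*} [Fintype n] [DecidableEq n]

/- **Sector projector** `P_K`: the orthogonal projection (`projMatrix`) onto `K ≤ ℂⁿ` transported to
`EuclideanSpace ℂ n` — a local notation only (the argument shape of the Literature lemmas
`trace_projMatrix_map_eq_finrank`, `projMatrix_map_mulVec_mem`, …), so that no new definition
enters the tree; every statement below is about this explicit matrix. -/
set_option quotPrecheck false in
local notation "𝐏[" K "]" => projMatrix (Submodule.map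
    ((WithLp.linearEquiv 2 ℂ (n → ℂ)).symm : (n → ℂ) →ₗ[ℂ] EuclideanSpace ℂ n) K)

/-! ### Thermal penalty transfer with an explicit price -/

/-- **Theorem 18 (abstract): thermal penalty transfer with the entropy price.** `A`, `O` Hermitian
leaving `K` invariant, `s > 0`, `β > 0`. If the canonical sector Gibbs state of the penalised
`A + s O` at inverse temperature `β` has `a ≤ re ⟨O⟩_{K,β}`, then EVERY unit ground state `φ ∈ K`
of `A` (`A φ = minEnergyOn A K · φ`) has `a - log (dim K) / (β s) ≤ re ⟨φ, O φ⟩`. No gap, no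
uniqueness, no `β → ∞`: the price of positive temperature is the explicit `log (dim K) / (β s)`.
[this work] -/
theorem groundState_re_rayleigh_ge_of_sectorGibbs_penalised {A O : Matrix n n ℂ}
    (hA : A.IsHermitian) (hO : O.IsHermitian) (K : Submodule ℂ (n → ℂ))
    (hKA : ∀ v ∈ K, A *ᵥ v ∈ K) (hKO : ∀ v ∈ K, O *ᵥ v ∈ K) {s β : ℝ} (hs : 0 < s)
    (hβ : 0 < β) {a : ℝ}
    (ha : a ≤ ((𝐏[K] * gibbsWeight β (A + (s : ℂ) • O) * O).trace /
      (𝐏[K] * gibbsWeight β (A + (s : ℂ) • O)).trace).re)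
    {φ : n → ℂ} (hφK : φ ∈ K) (hφ1 : star φ ⬝ᵥ φ = 1)
    (hφA : A *ᵥ φ = ((A.minEnergyOn K : ℝ) : ℂ) • φ) :
    a - Real.log (Module.finrank ℂ K) / (β * s) ≤ (star φ ⬝ᵥ O *ᵥ φ).re := by
  have hB : (A + (s : ℂ) • O).IsHermitian := isHermitian_add_ofReal_smul hA hO s
  have hinv : ∀ v ∈ K, (A + (s : ℂ) • O) *ᵥ v ∈ K := fun v hv => by
    rw [add_mulVec, smul_mulVec]
    exact K.add_mem (hKA v hv) (K.smul_mem _ (hKO v hv))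
  have hK : K ≠ ⊥ := by
    rintro rfl
    rw [Submodule.mem_bot] at hφK
    rw [hφK] at hφ1
    simp at hφ1
  have hZpos := re_trace_sectorGibbs_pos hB K hinv hK β
  -- (i) `A ≥ E₀(A)` on `K`
  have h1 : A.minEnergyOn K * (𝐏[K] * gibbsWeight β (A + (s : ℂ) • O)).trace.re ≤
      (𝐏[K] * gibbsWeight β (A + (s : ℂ) • O) * A).trace.re :=
    mul_re_trace_sectorGibbs_le hB K β hKA fun v hv => minEnergyOn_mul_le_re_rayleigh hA K hv
  -- (ii) linearity in the observable
  have h2 : (𝐏[K] * gibbsWeight β (A + (s : ℂ) • O) * (A + (s : ℂ) • O)).trace.re =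
      (𝐏[K] * gibbsWeight β (A + (s : ℂ) • O) * A).trace.re +
        s * (𝐏[K] * gibbsWeight β (A + (s : ℂ) • O) * O).trace.re := by
    rw [Matrix.mul_add, Matrix.mul_smul, trace_add, trace_smul, Complex.add_re, smul_eq_mul,
      Complex.re_ofReal_mul]
  -- (iii) the entropy price
  have h3 := re_trace_sectorGibbs_hamiltonian_le hB K hinv hK hβ
  -- (iv) `E₀(A + sO) ≤ ⟨φ, (A + sO) φ⟩ = E₀(A) + s re⟨φ, O φ⟩`
  have h4 : (A + (s : ℂ) • O).minEnergyOn K ≤ A.minEnergyOn K + s * (star φ ⬝ᵥ O *ᵥ φ).re := by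
    have h := minEnergyOn_le_rayleigh_of_mem hB K hφK hφ1
    rw [add_mulVec, smul_mulVec, dotProduct_add, dotProduct_smul, Complex.add_re, smul_eq_mul,
      Complex.re_ofReal_mul, hφA, dotProduct_smul, hφ1, smul_eq_mul, mul_one,
      Complex.ofReal_re] at h
    exact h
  have h5 : ((A + (s : ℂ) • O).minEnergyOn K + Real.log (Module.finrank ℂ K) / β) *
      (𝐏[K] * gibbsWeight β (A + (s : ℂ) • O)).trace.re ≤
      (A.minEnergyOn K + s * (star φ ⬝ᵥ O *ᵥ φ).re + Real.log (Module.finrank ℂ K) / β) *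
        (𝐏[K] * gibbsWeight β (A + (s : ℂ) • O)).trace.re :=
    mul_le_mul_of_nonneg_right (by linarith) hZpos.le
  have hX : s * (𝐏[K] * gibbsWeight β (A + (s : ℂ) • O) * O).trace.re ≤
      (s * (star φ ⬝ᵥ O *ᵥ φ).re + Real.log (Module.finrank ℂ K) / β) *
        (𝐏[K] * gibbsWeight β (A + (s : ℂ) • O)).trace.re := by
    linarith
  rw [re_sectorGibbs_div_eq hB K β O, le_div_iff₀ hZpos] at ha
  have h6 : s * a * (𝐏[K] * gibbsWeight β (A + (s : ℂ) • O)).trace.re ≤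
      (s * (star φ ⬝ᵥ O *ᵥ φ).re + Real.log (Module.finrank ℂ K) / β) *
        (𝐏[K] * gibbsWeight β (A + (s : ℂ) • O)).trace.re := by
    have h := mul_le_mul_of_nonneg_left ha hs.le
    linarith
  have h7 : s * a ≤ s * (star φ ⬝ᵥ O *ᵥ φ).re + Real.log (Module.finrank ℂ K) / β :=
    le_of_mul_le_mul_right h6 hZpos
  have hs0 : s ≠ 0 := hs.ne'
  have hβ0 : β ≠ 0 := hβ.ne'
  have h8 : a ≤ (star φ ⬝ᵥ O *ᵥ φ).re + Real.log (Module.finrank ℂ K) / (β * s) := by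
    refine le_of_mul_le_mul_left ?_ hs
    have : s * ((star φ ⬝ᵥ O *ᵥ φ).re + Real.log (Module.finrank ℂ K) / (β * s)) =
        s * (star φ ⬝ᵥ O *ᵥ φ).re + Real.log (Module.finrank ℂ K) / β := by
      field_simp
    rw [this]
    exact h7
  linarith

/-- **Converse direction: a zero-temperature certificate survives at positive temperature.**
`A`, `O` Hermitian leaving `K ≠ ⊥` invariant, `0 ≤ re⟨v, O v⟩` everywhere, `re⟨φ, O φ⟩ ≤ Bd` and
the certificate `a ≤ re⟨φ,Oφ⟩ + κ (re⟨φ,Aφ⟩ - minEnergyOn A K)` (`κ ≥ 0`) on the unit sphere of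
`K`. Then for all `s, β > 0` the sector Gibbs state of `A + sO` has
`re ⟨O⟩_{K,β} ≥ a - κ (s Bd + log (dim K) / β)`
(average the homogeneous certificate over `ρ = Σⱼ e^{-βλⱼ} |P uⱼ⟩⟨P uⱼ| / Z` and bound
`⟨A⟩_ρ - E₀(A) ≤ ⟨A + sO⟩_ρ - E₀(A + sO) + s Bd ≤ log (dim K)/β + s Bd`). [this work] -/
theorem re_sectorGibbs_penalised_ge_of_certificate {A O : Matrix n n ℂ}
    (hA : A.IsHermitian) (hO : O.IsHermitian) (K : Submodule ℂ (n → ℂ))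
    (hKA : ∀ v ∈ K, A *ᵥ v ∈ K) (hKO : ∀ v ∈ K, O *ᵥ v ∈ K) (hK : K ≠ ⊥)
    (hO0 : ∀ v : n → ℂ, 0 ≤ (star v ⬝ᵥ O *ᵥ v).re) {Bd : ℝ}
    (hOB : ∀ φ ∈ K, star φ ⬝ᵥ φ = 1 → (star φ ⬝ᵥ O *ᵥ φ).re ≤ Bd)
    {a κ : ℝ} (hκ : 0 ≤ κ)
    (hcert : ∀ φ ∈ K, star φ ⬝ᵥ φ = 1 →
      a ≤ (star φ ⬝ᵥ O *ᵥ φ).re + κ * ((star φ ⬝ᵥ A *ᵥ φ).re - A.minEnergyOn K))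
    {s β : ℝ} (hs : 0 < s) (hβ : 0 < β) :
    a - κ * (s * Bd + Real.log (Module.finrank ℂ K) / β) ≤
      ((𝐏[K] * gibbsWeight β (A + (s : ℂ) • O) * O).trace /
        (𝐏[K] * gibbsWeight β (A + (s : ℂ) • O)).trace).re := by
  have hB : (A + (s : ℂ) • O).IsHermitian := isHermitian_add_ofReal_smul hA hO s
  have hinv : ∀ v ∈ K, (A + (s : ℂ) • O) *ᵥ v ∈ K := fun v hv => by
    rw [add_mulVec, smul_mulVec]
    exact K.add_mem (hKA v hv) (K.smul_mem _ (hKO v hv))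
  have hZpos := re_trace_sectorGibbs_pos hB K hinv hK β
  -- homogeneous certificate on all of `K`
  have hhom : ∀ v ∈ K, a * (star v ⬝ᵥ v).re ≤
      (star v ⬝ᵥ O *ᵥ v).re + κ * ((star v ⬝ᵥ A *ᵥ v).re - A.minEnergyOn K * (star v ⬝ᵥ v).re) := by
    intro v hv
    by_cases hv0 : v = 0
    · simp [hv0]
    obtain ⟨c, _, hcc, hc1⟩ := exists_normalize hv0
    have h := hcert _ (K.smul_mem (c : ℂ) hv) hc1
    rw [mulVec_smul, mulVec_smul, star_real_smul_dotProduct_real_smul,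
      star_real_smul_dotProduct_real_smul, Complex.re_ofReal_mul, Complex.re_ofReal_mul] at h
    have hnn : 0 ≤ (star v ⬝ᵥ v).re := re_star_dotProduct_self_nonneg v
    have h' := mul_le_mul_of_nonneg_right h hnn
    have e : (c * c * (star v ⬝ᵥ O *ᵥ v).re +
        κ * (c * c * (star v ⬝ᵥ A *ᵥ v).re - A.minEnergyOn K)) * (star v ⬝ᵥ v).re =
        (star v ⬝ᵥ O *ᵥ v).re +
          κ * ((star v ⬝ᵥ A *ᵥ v).re - A.minEnergyOn K * (star v ⬝ᵥ v).re) := by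
      linear_combination ((star v ⬝ᵥ O *ᵥ v).re + κ * (star v ⬝ᵥ A *ᵥ v).re) * hcc
    rw [e] at h'
    exact h'
  -- average it over the Gibbs decomposition
  have havg : a * (𝐏[K] * gibbsWeight β (A + (s : ℂ) • O)).trace.re ≤
      (𝐏[K] * gibbsWeight β (A + (s : ℂ) • O) * O).trace.re +
        κ * ((𝐏[K] * gibbsWeight β (A + (s : ℂ) • O) * A).trace.re -
          A.minEnergyOn K * (𝐏[K] * gibbsWeight β (A + (s : ℂ) • O)).trace.re) := by
    rw [trace_proj_gibbsWeight_eq_sum hB K β, trace_proj_gibbsWeight_mul_eq_sum hB K β hKO,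
      trace_proj_gibbsWeight_mul_eq_sum hB K β hKA, Complex.re_sum, Complex.re_sum,
      Complex.re_sum, Finset.mul_sum, Finset.mul_sum, ← Finset.sum_sub_distrib, Finset.mul_sum,
      ← Finset.sum_add_distrib]
    refine Finset.sum_le_sum fun j _ => ?_
    rw [Complex.re_ofReal_mul, Complex.re_ofReal_mul, Complex.re_ofReal_mul]
    have h := mul_le_mul_of_nonneg_left (hhom _ (projMatrix_map_mulVec_mem K
      (fun i => (hB.eigenvectorUnitary : Matrix n n ℂ) i j))) (Real.exp_nonneg
        (-(β * hB.eigenvalues j)))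
    linarith
  -- `⟨A⟩ - E₀(A) Z ≤ (s Bd + log D / β) Z`
  have h2 : (𝐏[K] * gibbsWeight β (A + (s : ℂ) • O) * (A + (s : ℂ) • O)).trace.re =
      (𝐏[K] * gibbsWeight β (A + (s : ℂ) • O) * A).trace.re +
        s * (𝐏[K] * gibbsWeight β (A + (s : ℂ) • O) * O).trace.re := by
    rw [Matrix.mul_add, Matrix.mul_smul, trace_add, trace_smul, Complex.add_re, smul_eq_mul,
      Complex.re_ofReal_mul]
  have h3 := re_trace_sectorGibbs_hamiltonian_le hB K hinv hK hβ
  have hTO0 : 0 * (𝐏[K] * gibbsWeight β (A + (s : ℂ) • O)).trace.re ≤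
      (𝐏[K] * gibbsWeight β (A + (s : ℂ) • O) * O).trace.re :=
    mul_re_trace_sectorGibbs_le hB K β hKO fun v _ => by rw [zero_mul]; exact hO0 v
  obtain ⟨φ₀, hφ₀K, hφ₀1, hφ₀A⟩ := exists_unit_eigen_minEnergyOn hA K hKA hK
  have h4 : (A + (s : ℂ) • O).minEnergyOn K ≤ A.minEnergyOn K + s * Bd := by
    have h := minEnergyOn_le_rayleigh_of_mem hB K hφ₀K hφ₀1
    rw [add_mulVec, smul_mulVec, dotProduct_add, dotProduct_smul, Complex.add_re, smul_eq_mul,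
      Complex.re_ofReal_mul, hφ₀A, dotProduct_smul, hφ₀1, smul_eq_mul, mul_one,
      Complex.ofReal_re] at h
    have h' := mul_le_mul_of_nonneg_left (hOB φ₀ hφ₀K hφ₀1) hs.le
    linarith
  have h5 : ((A + (s : ℂ) • O).minEnergyOn K + Real.log (Module.finrank ℂ K) / β) *
      (𝐏[K] * gibbsWeight β (A + (s : ℂ) • O)).trace.re ≤
      (A.minEnergyOn K + s * Bd + Real.log (Module.finrank ℂ K) / β) *
        (𝐏[K] * gibbsWeight β (A + (s : ℂ) • O)).trace.re :=
    mul_le_mul_of_nonneg_right (by linarith) hZpos.le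
  have h6 : (𝐏[K] * gibbsWeight β (A + (s : ℂ) • O) * A).trace.re -
      A.minEnergyOn K * (𝐏[K] * gibbsWeight β (A + (s : ℂ) • O)).trace.re ≤
      (s * Bd + Real.log (Module.finrank ℂ K) / β) *
        (𝐏[K] * gibbsWeight β (A + (s : ℂ) • O)).trace.re := by
    have h7 := mul_le_mul_of_nonneg_left hTO0 hs.le
    nlinarith [h2, h3, h5, h7, hZpos]
  have h8 := mul_le_mul_of_nonneg_left h6 hκ
  rw [re_sectorGibbs_div_eq hB K β O, le_div_iff₀ hZpos]
  nlinarith [havg, h8, hZpos]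

end Abstract

end Summit.HubbardSuperconductivity.HubbardSuperconductivity.Theorems

end
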